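import Mathlib.Data.Real.Basic
import Mathlib.Tactic.Linarith
import Mathlib.Tactic.Ring
import Mathlib.Tactic.Positivity
import HarnessLib
import HarnessLib.Audit

/-!
# `NoHeavyLowerTail` (crux stmt-CriticalPhenomena-4575), Sahi programme P4: PAIR inequality for the OR of two disjoint principal
# blocks — HOMOGENEOUS (mass) form of the algebraic core

Support file (cell `prim-l12`, seat P4, generation 12; `--supports stmt-CriticalPhenomena-4575`).  No named facts, no sorries;
standard axioms; def-free; pure real algebra.  Companion of `…SahiE3DnfPairAlgebra` (normalised form).

Two blocks `Q_A ∋ t_A` (greatest), `Q_B ∋ t_B` with weights; `P_A = ν_A(t_A)`, `Q_A' = ν_A(Q_A ∖ t_A)` (written `QA`), likewise `PB, QB`;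
`Z = (PA+QA)(PB+QB)`, receivers `D = (Q_A∖t_A) × (Q_B∖t_B)` of mass `QA·QB`, `N_U = Z − QA·QB`, `Δ' = PA·QB + QA·PB`.  For up-sets
`S, T ∋ (t_A,t_B)` of `Q_A × Q_B` the face masses are `σ_S = ν_B{b ≠ t_B : (t_A,b) ∈ S}`, `τ_S = ν_A{a ≠ t_A : (a,t_B) ∈ S}`,
`ρ_S = ν(S ∩ D)`, and for `W = S ∩ T` likewise `σ_W, τ_W`.  The explicit certificate of the slot `U = {a = t_A ∨ b = t_B}` is
`R = Z(Z+QA·QB)ν` on `U` minus the loads `θ_A Z N_U QA ν_B(b)` on `(t_A,b)`, `θ_B Z N_U QB ν_A(a)` on `(a,t_B)`,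
`θ_A = PA·QB/Δ'`, `θ_B = QA·PB/Δ'`.  THEOREM `dnf_two_pair_hom`: `Δ'·(R(W ∩ U) − need(S,T)) ≥ 0`, as the explicit sum of products
  `K'(Z_A PA Φ₁ + Z_B PB Φ₂) + Z PA²PB QB[(QB−σ_S)τ_T + (QB−σ_T)τ_S] + Z QA PA PB²[(QA−τ_S)σ_T + (QA−τ_T)σ_S]`
  `+ PA²PB²[QB²(QA−τ_S)(QA−τ_T) + QA²(QB−σ_S)(QB−σ_T)] + QA²PA PB²[(QB−σ_S)M^Y_T + M^Y_S(QB−σ_T)] + PB(PA QB Z_A + QA²PB)M^Y_S M^Y_T`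
  `+ PA(QB Δ' + QA PB²)M^X_S M^X_T + QB²PA²PB[(QA−τ_S)M^X_T + M^X_S(QA−τ_T)]`,
with `K' = Δ'Z − QA·QB·PA·PB ≥ 0`, `Φ₁ = Z_B(PB+σ_W) − (PB+σ_S)(PB+σ_T) ≥ 0` (Harris in the face `a = t_A`), `Φ₂` likewise,
`M^Y_S = QB τ_S − ρ_S ≥ 0`, `M^X_S = QA σ_S − ρ_S ≥ 0` (monotone sections).  Identity found by LP over the section abstraction and
verified exactly on all block posets `2^a × 2^b`, `a + b ≤ 4`, with arbitrary (also vanishing) weights (HOME code/gen12/homog2.py).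
-/

namespace Summit.CriticalPhenomena.PercolationContinuityZ3.Theorems.SahiE3DnfPairAlgebraHom

/-- **PAIR for the OR of two disjoint principal blocks, homogeneous form** (see the module docstring for the notation).
All hypotheses are sign conditions on masses; the conclusion is `0 ≤ Δ'·R(W∩U) − Δ'·need(S,T)` written out. [this work] -/
theorem dnf_two_pair_hom (PA QA PB QB σS τS ρS σT τT ρT σW τW : ℝ)
    (hPA : 0 ≤ PA) (hQA : 0 ≤ QA) (hPB : 0 ≤ PB) (hQB : 0 ≤ QB)
    (hσS : 0 ≤ σS) (hσS' : σS ≤ QB) (hτS : 0 ≤ τS) (hτS' : τS ≤ QA) (hρS₁ : ρS ≤ QA * σS) (hρS₂ : ρS ≤ QB * τS)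
    (hσT : 0 ≤ σT) (hσT' : σT ≤ QB) (hτT : 0 ≤ τT) (hτT' : τT ≤ QA) (hρT₁ : ρT ≤ QA * σT) (hρT₂ : ρT ≤ QB * τT)
    (hΦ₁ : (PB + σS) * (PB + σT) ≤ (PB + QB) * (PB + σW))
    (hΦ₂ : (PA + τS) * (PA + τT) ≤ (PA + QA) * (PA + τW)) :
    0 ≤ (PA * QB + QA * PB) * (((PA + QA) * (PB + QB)) * ((PA + QA) * (PB + QB) + QA * QB)
            * (PA * PB + PA * σW + PB * τW))
        - ((PA + QA) * (PB + QB)) * ((PA + QA) * (PB + QB) - QA * QB) * (PA * QB * QA * σW + QA * PB * QB * τW)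
        - (PA * QB + QA * PB) *
          (((PA + QA) * (PB + QB)) *
              ((PA * PB + PA * σS + PB * τS + ρS) * (PA * PB + PA * σT + PB * τT)
                + (PA * PB + PA * σT + PB * τT + ρT) * (PA * PB + PA * σS + PB * τS))
            - ((PA + QA) * (PB + QB) - QA * QB) * (PA * PB + PA * σS + PB * τS + ρS) * (PA * PB + PA * σT + PB * τT + ρT)) := by
  have hZA : 0 ≤ PA + QA := by linarith
  have hZB : 0 ≤ PB + QB := by linarith
  have hK : 0 ≤ (PA * QB + QA * PB) * ((PA + QA) * (PB + QB)) - QA * QB * PA * PB := by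
    nlinarith [mul_nonneg (mul_nonneg hPA hQB) (mul_nonneg hPA hPB), mul_nonneg (mul_nonneg hPA hQB) (mul_nonneg hPA hQB),
      mul_nonneg (mul_nonneg hPA hQB) (mul_nonneg hQA hQB), mul_nonneg (mul_nonneg hQA hPB) (mul_nonneg hPA hPB),
      mul_nonneg (mul_nonneg hQA hPB) (mul_nonneg hQA hPB), mul_nonneg (mul_nonneg hQA hPB) (mul_nonneg hQA hQB),
      mul_nonneg (mul_nonneg hQA hPB) (mul_nonneg hPA hQB)]
  have hF₁ : 0 ≤ (PB + QB) * (PB + σW) - (PB + σS) * (PB + σT) := by linarith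
  have hF₂ : 0 ≤ (PA + QA) * (PA + τW) - (PA + τS) * (PA + τT) := by linarith
  have hX : 0 ≤ QB - σS := by linarith
  have hX' : 0 ≤ QB - σT := by linarith
  have hY : 0 ≤ QA - τS := by linarith
  have hY' : 0 ≤ QA - τT := by linarith
  have hMYS : 0 ≤ QB * τS - ρS := by linarith
  have hMYT : 0 ≤ QB * τT - ρT := by linarith
  have hMXS : 0 ≤ QA * σS - ρS := by linarith
  have hMXT : 0 ≤ QA * σT - ρT := by linarith
  have P0 : 0 ≤ ((PA * QB + QA * PB) * ((PA + QA) * (PB + QB)) - QA * QB * PA * PB)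
      * ((PA + QA) * PA * ((PB + QB) * (PB + σW) - (PB + σS) * (PB + σT))
        + (PB + QB) * PB * ((PA + QA) * (PA + τW) - (PA + τS) * (PA + τT))) :=
    mul_nonneg hK (add_nonneg (mul_nonneg (mul_nonneg hZA hPA) hF₁) (mul_nonneg (mul_nonneg hZB hPB) hF₂))
  have P1 : 0 ≤ ((PA + QA) * (PB + QB)) * (PA * PA) * PB * QB * ((QB - σS) * τT + (QB - σT) * τS) := by
    have := add_nonneg (mul_nonneg hX hτT) (mul_nonneg hX' hτS); positivity
  have P2 : 0 ≤ ((PA + QA) * (PB + QB)) * QA * PA * (PB * PB) * ((QA - τS) * σT + (QA - τT) * σS) := by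
    have := add_nonneg (mul_nonneg hY hσT) (mul_nonneg hY' hσS); positivity
  have P3 : 0 ≤ (PA * PA) * (PB * PB) * ((QB * QB) * ((QA - τS) * (QA - τT)) + (QA * QA) * ((QB - σS) * (QB - σT))) := by
    have h1 := mul_nonneg hY hY'; have h2 := mul_nonneg hX hX'; positivity
  have P4 : 0 ≤ (QA * QA) * PA * (PB * PB) * ((QB - σS) * (QB * τT - ρT) + (QB * τS - ρS) * (QB - σT)) := by
    have := add_nonneg (mul_nonneg hX hMYT) (mul_nonneg hMYS hX'); positivity
  have P5 : 0 ≤ PB * (PA * QB * (PA + QA) + QA * QA * PB) * ((QB * τS - ρS) * (QB * τT - ρT)) := by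
    have := mul_nonneg hMYS hMYT; positivity
  have P6 : 0 ≤ PA * (QB * (PA * QB + QA * PB) + QA * (PB * PB)) * ((QA * σS - ρS) * (QA * σT - ρT)) := by
    have := mul_nonneg hMXS hMXT; positivity
  have P7 : 0 ≤ (QB * QB) * (PA * PA) * PB * ((QA - τS) * (QA * σT - ρT) + (QA * σS - ρS) * (QA - τT)) := by
    have := add_nonneg (mul_nonneg hY hMXT) (mul_nonneg hMXS hY'); positivity
  linarith [P0, P1, P2, P3, P4, P5, P6, P7]

end Summit.CriticalPhenomena.PercolationContinuityZ3.Theorems.SahiE3DnfPairAlgebraHom
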